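import Literature.AnabelianGeometry.SemiGraphs.TemperedPiCompactOfNoClosedEdge
import Literature.AnabelianGeometry.SemiGraphs.TemperedCompactInVerticialFinite
import HarnessLib

/-!
# One vertex: `π₁^temp(𝒢) = π̂₁(𝒢_v)` — the verticial homomorphism is an isomorphism of topological
# groups when `𝔾` has no closed edge ([SemiAnbd] Thm. 3.7 (i), (iii) pp. 40–41; §1 p. 12)

Mochizuki, *Semi-graphs of anabelioids*, Publ. RIMS **42** (2006) [SemiAnbd], Thm. 3.7 (i) p. 40 ("a
natural continuous injective outer homomorphism `π̂₁(𝒢_v) ↪ π₁^temp(𝒢)` … the verticial subgroups"),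
Thm. 3.7 (iii) pp. 40–41 ("Every compact subgroup of `π₁^temp(𝒢)` is contained in at least one verticial
subgroup"), §1 p. 12 (closed / open edges). [cite: MochizukiSemiAnbd2006, Thm 3.7(i)(iii) pp.40-41]

PROOF-ONLY file (abc-iut cell, prover abc-iut-w5-d240; no definitions, no instances, no named facts),
sequel of `TemperedPiCompactOfNoClosedEdge.lean` (for `𝒢` in the class of Prop. 3.6 with finitely many
vertices and edges and NO closed edge, every chart `c.G` of `π₁^temp(𝒢)` is compact).  Under the
hypotheses of Thm. 3.7 this pins the group down completely:

* `SemiGraph.subsingleton_vertex_of_forall_not_isClosedEdge` — a connected semi-graph without closed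
  edges has at most one vertex (a path between two vertices crosses an edge through two distinct
  abutting branches);
* `TemperedPiChart.top_mem_verticialSubgroups_of_forall_not_isClosedEdge` — with no closed edge, the
  whole group `⊤ ≤ c.G` (compact) lies in a verticial subgroup (finite-graph Thm. 3.7 (iii),
  `compactInVerticialAt_of_finiteGraph`), so `⊤` IS a verticial subgroup at some vertex;
* `TemperedPiChart.exists_isVerticialHom_bijective_of_forall_not_isClosedEdge` — hence some verticial
  homomorphism `φ : Π_v → c.G` is bijective (injective by Thm. 3.7 (i), `verticialInjective_holds`);
* `TemperedPiChart.nonempty_continuousMulEquiv_Gv_of_forall_not_isClosedEdge` — a continuous bijection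
  from the compact `Π_v` onto the Hausdorff `c.G` is a homeomorphism: **`π̂₁(𝒢_v) ≃ₜ* π₁^temp(𝒢)` for
  every chart and every vertex** (there is only one) — the shape "one vertex carrying cusps" of the
  special fibre of a curve with good reduction in [SemiAnbd] Ex. 3.10, where the tempered and the
  profinite fundamental groups coincide.  Generalises the cell's witness-level
  `verticialSubgroups_chart_affWitness_eq` / `compactSpace_chart_affWitness` (one vertex, no edges,
  `Π_v = Aff(ℤ_p)`) to every such `𝒢`.

Classical material (2006); nothing here bears on [IUTchIII] Cor. 3.12 or takes a side on any disputed claim.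
-/

noncomputable section

namespace Literature.AnabelianGeometry.SemiGraphs

open CategoryTheory
open _root_.Topology

universe u

/-! ### 1. A connected semi-graph without closed edges has at most one vertex -/

/-- **A connected semi-graph with no closed edge has at most one vertex**: a path in the barycentric
subdivision from a vertex `v` to a vertex `w ≠ v` leaves `v` through an abutting branch `b`, reaches
the edge `e` of `b`, continues through a second branch `b' ≠ b` of `e`, and can only go on to a vertex
`b'` abuts to — so `e` has two abutting branches, i.e. is closed. [cite: MochizukiSemiAnbd2006, §1 p.12] -/
theorem SemiGraph.subsingleton_vertex_of_forall_not_isClosedEdge {G : SemiGraph.{u}}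
    (hG : G.IsConnected) (hcl : ∀ e : G.Edge, ¬ G.IsClosedEdge e) : Subsingleton G.Vertex := by
  classical
  refine ⟨fun v w => ?_⟩
  by_contra hvw
  obtain ⟨p, hp⟩ := hG.connected.exists_isPath (Sum.inl v) (Sum.inl w)
  have hinj : ∀ i j : ℕ, i ≤ p.length → j ≤ p.length → p.getVert i = p.getVert j → i = j :=
    fun i j hi hj h => hp.getVert_injOn hi hj h
  have hl0 : p.length ≠ 0 := fun h => by
    have h' := p.eq_of_length_eq_zero h
    exact hvw (Sum.inl_injective h')
  -- node 1: a branch `b` abutting to `v`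
  have h01 := p.adj_getVert_succ (i := 0) (by omega)
  rw [p.getVert_zero] at h01
  obtain ⟨b, hbv, h1⟩ := (G.subdivision_adj_inl_iff v _).mp h01
  have hl1 : p.length ≠ 1 := fun h => by
    have h2 : p.getVert 1 = Sum.inl w := h ▸ p.getVert_length
    rw [h1] at h2
    simp at h2
  -- node 2: the edge of `b` (going back to a vertex would be going back to `v`)
  have h12 := p.adj_getVert_succ (i := 1) (by omega)
  rw [h1] at h12
  rcases (G.subdivision_adj_branch_iff b _).mp h12 with h2 | ⟨u, hu, h2⟩
  swap
  · exfalso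
    rw [hbv] at hu
    cases hu
    have : (2 : ℕ) = 0 := hinj 2 0 (by omega) (by omega) (by rw [h2, p.getVert_zero])
    omega
  have hl2 : p.length ≠ 2 := fun h => by
    have h3 : p.getVert 2 = Sum.inl w := h ▸ p.getVert_length
    rw [h2] at h3
    simp at h3
  -- node 3: another branch `b' ≠ b` of `edgeOf b`
  have h23 := p.adj_getVert_succ (i := 2) (by omega)
  rw [h2] at h23
  obtain ⟨b', hb'e, h3⟩ := (G.subdivision_adj_edge_iff _ _).mp h23
  have hbb' : b' ≠ b := by
    rintro rfl
    have : (3 : ℕ) = 1 := hinj 3 1 (by omega) (by omega) (by rw [h3, h1])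
    omega
  have hl3 : p.length ≠ 3 := fun h => by
    have h4 : p.getVert 3 = Sum.inl w := h ▸ p.getVert_length
    rw [h3] at h4
    simp at h4
  -- node 4: `b'` abuts to a vertex (it cannot go back to its edge)
  have h34 := p.adj_getVert_succ (i := 3) (by omega)
  rw [h3] at h34
  rcases (G.subdivision_adj_branch_iff b' _).mp h34 with h4 | ⟨u, hu, -⟩
  · exfalso
    have : (4 : ℕ) = 2 := hinj 4 2 (by omega) (by omega) (by rw [h4, h2, hb'e])
    omega
  -- two distinct abutting branches of `edgeOf b`: a closed edge
  exact hbb' (SemiGraph.branch_eq_of_not_isClosedEdge hb'e (by rw [hbv]; rfl) (by rw [hu]; rfl)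
    (hcl _))

namespace ProfiniteSemiGraph

variable {𝒢 : ProfiniteSemiGraph.{u}} (c : TemperedPiChart 𝒢)

/-! ### 2. `⊤` is a verticial subgroup; the verticial homomorphism is bijective -/

/-- **With no closed edge, `⊤` is a verticial subgroup of `π₁^temp(𝒢)`** (for `𝒢` satisfying the
hypotheses of Thm. 3.7 with finitely many vertices and edges): the chart group `c.G` is compact
(`TemperedPiChart.compactSpace_of_forall_not_isClosedEdge`), so by the finite-graph Thm. 3.7 (iii)
(`compactInVerticialAt_of_finiteGraph`) the compact subgroup `⊤` lies in — hence equals — a verticial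
subgroup. [cite: MochizukiSemiAnbd2006, Thm 3.7(iii) pp.40-41] -/
theorem TemperedPiChart.top_mem_verticialSubgroups_of_forall_not_isClosedEdge (h37 : 𝒢.Thm37Hypotheses)
    [Finite 𝒢.graph.Vertex] [Finite 𝒢.graph.Edge] (hcl : ∀ e : 𝒢.graph.Edge, ¬ 𝒢.graph.IsClosedEdge e) :
    ∃ v : 𝒢.graph.Vertex, (⊤ : Subgroup c.G) ∈ verticialSubgroups c v := by
  haveI := c.compactSpace_of_forall_not_isClosedEdge h37.toProp36Hypotheses hcl
  have htop : IsCompact ((⊤ : Subgroup c.G) : Set c.G) := by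
    rw [Subgroup.coe_top]
    exact isCompact_univ
  obtain ⟨⟨v, H, hH, hle⟩, -⟩ := compactInVerticialAt_of_finiteGraph h37 c ⊤ htop
  exact ⟨v, (top_le_iff.mp hle) ▸ hH⟩

/-- **With no closed edge, `⊤` is a verticial subgroup at EVERY vertex** (there is only one vertex,
`SemiGraph.subsingleton_vertex_of_forall_not_isClosedEdge`). [cite: MochizukiSemiAnbd2006, Thm 3.7(iii) pp.40-41] -/
theorem TemperedPiChart.top_mem_verticialSubgroups_of_forall_not_isClosedEdge' (h37 : 𝒢.Thm37Hypotheses)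
    [Finite 𝒢.graph.Vertex] [Finite 𝒢.graph.Edge] (hcl : ∀ e : 𝒢.graph.Edge, ¬ 𝒢.graph.IsClosedEdge e)
    (v : 𝒢.graph.Vertex) : (⊤ : Subgroup c.G) ∈ verticialSubgroups c v := by
  haveI := SemiGraph.subsingleton_vertex_of_forall_not_isClosedEdge h37.isConnected hcl
  obtain ⟨w, hw⟩ := c.top_mem_verticialSubgroups_of_forall_not_isClosedEdge h37 hcl
  exact (Subsingleton.elim w v) ▸ hw

/-- **With no closed edge, some verticial homomorphism `Π_v → π₁^temp(𝒢)` at every vertex `v` is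
BIJECTIVE**: surjective because its range `⊤` is the verticial subgroup just found, injective by
Thm. 3.7 (i) (`verticialInjective_holds`). [cite: MochizukiSemiAnbd2006, Thm 3.7(i) p.40] -/
theorem TemperedPiChart.exists_isVerticialHom_bijective_of_forall_not_isClosedEdge
    (h37 : 𝒢.Thm37Hypotheses) [Finite 𝒢.graph.Vertex] [Finite 𝒢.graph.Edge]
    (hcl : ∀ e : 𝒢.graph.Edge, ¬ 𝒢.graph.IsClosedEdge e) (v : 𝒢.graph.Vertex) :
    ∃ φ : 𝒢.Gv v →ₜ* c.G, IsVerticialHom c v φ ∧ Function.Bijective φ := by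
  obtain ⟨φ, hφ, htop⟩ := c.top_mem_verticialSubgroups_of_forall_not_isClosedEdge' h37 hcl v
  refine ⟨φ, hφ, (verticialInjective_holds 𝒢 h37 c v).2 φ hφ, ?_⟩
  exact MonoidHom.range_eq_top.mp htop.symm

/-! ### 3. `π̂₁(𝒢_v) ≃ₜ* π₁^temp(𝒢)` -/

/-- **One vertex carrying cusps: `π₁^temp(𝒢) = π̂₁(𝒢_v)`.**  For `𝒢` satisfying the hypotheses of
Thm. 3.7 with finitely many vertices and edges and NO closed edge, and every chart `c` and vertex `v`,
there is an isomorphism of topological groups `Π_v ≃ₜ* c.G` which is a verticial homomorphism (a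
continuous bijection from the compact `Π_v` onto the Hausdorff `c.G` is a homeomorphism) — the
tempered fundamental group of a one-vertex semi-graph of anabelioids is the (profinite) vertex group.
[cite: MochizukiSemiAnbd2006, Thm 3.7(i)(iii) pp.40-41] -/
theorem TemperedPiChart.exists_continuousMulEquiv_isVerticialHom_of_forall_not_isClosedEdge
    (h37 : 𝒢.Thm37Hypotheses) [Finite 𝒢.graph.Vertex] [Finite 𝒢.graph.Edge]
    (hcl : ∀ e : 𝒢.graph.Edge, ¬ 𝒢.graph.IsClosedEdge e) (v : 𝒢.graph.Vertex) :
    ∃ e : 𝒢.Gv v ≃ₜ* c.G, IsVerticialHom c v (e : 𝒢.Gv v →ₜ* c.G) := by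
  obtain ⟨φ, hφ, hbij⟩ := c.exists_isVerticialHom_bijective_of_forall_not_isClosedEdge h37 hcl v
  haveI := TemperedPiChart.t2Space c
  let h : 𝒢.Gv v ≃ₜ c.G := Continuous.homeoOfEquivCompactToT2 (f := Equiv.ofBijective φ hbij) φ.continuous
  let e : 𝒢.Gv v ≃ₜ* c.G :=
    { Equiv.ofBijective φ hbij with
      map_mul' := fun x y => map_mul φ x y
      continuous_toFun := h.continuous
      continuous_invFun := h.symm.continuous }
  refine ⟨e, ?_⟩
  have he : (e : 𝒢.Gv v →ₜ* c.G) = φ := ContinuousMonoidHom.ext fun _ => rfl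
  rw [he]
  exact hφ

/-- **`π̂₁(𝒢_v) ≅ π₁^temp(𝒢)` as topological groups** for a one-vertex semi-graph of anabelioids with
cusps (hypotheses of Thm. 3.7, finitely many vertices and edges, no closed edge), every chart, every
vertex. [cite: MochizukiSemiAnbd2006, Thm 3.7(i)(iii) pp.40-41] -/
theorem TemperedPiChart.nonempty_continuousMulEquiv_Gv_of_forall_not_isClosedEdge
    (h37 : 𝒢.Thm37Hypotheses) [Finite 𝒢.graph.Vertex] [Finite 𝒢.graph.Edge]
    (hcl : ∀ e : 𝒢.graph.Edge, ¬ 𝒢.graph.IsClosedEdge e) (v : 𝒢.graph.Vertex) :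
    Nonempty (𝒢.Gv v ≃ₜ* c.G) := by
  obtain ⟨e, -⟩ := c.exists_continuousMulEquiv_isVerticialHom_of_forall_not_isClosedEdge h37 hcl v
  exact ⟨e⟩

/-- The same at the MODEL `𝒢.temperedPi`: `π̂₁(𝒢_v) ≃ₜ* π₁^temp(𝒢)` for the tempered fundamental
group constructed in Prop. 3.6 (i)(ii) (the chart `𝒢.temperedPiChart`).
[cite: MochizukiSemiAnbd2006, Prop 3.6(ii) p.38] -/
theorem nonempty_continuousMulEquiv_Gv_temperedPi_of_forall_not_isClosedEdge
    (h37 : 𝒢.Thm37Hypotheses) [Finite 𝒢.graph.Vertex] [Finite 𝒢.graph.Edge]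
    (hcl : ∀ e : 𝒢.graph.Edge, ¬ 𝒢.graph.IsClosedEdge e) (v : 𝒢.graph.Vertex) :
    Nonempty (𝒢.Gv v ≃ₜ* 𝒢.temperedPi h37.toProp36Hypotheses) :=
  (𝒢.temperedPiChart h37.toProp36Hypotheses).nonempty_continuousMulEquiv_Gv_of_forall_not_isClosedEdge
    h37 hcl v

/-- Consequently, with no closed edge every verticial subgroup at any vertex is the image of `Π_v`
under an INJECTIVE continuous homomorphism into a group itself isomorphic to `Π_v`; in particular the
maximal compact subgroups of `π₁^temp(𝒢)` (Thm. 3.7 (iv), finite form) reduce to the single one `⊤`: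
every compact subgroup is contained in the verticial subgroup `⊤`. [cite: MochizukiSemiAnbd2006, Thm 3.7(iv) p.41] -/
theorem TemperedPiChart.isCompact_le_top_verticial_of_forall_not_isClosedEdge (h37 : 𝒢.Thm37Hypotheses)
    [Finite 𝒢.graph.Vertex] [Finite 𝒢.graph.Edge] (hcl : ∀ e : 𝒢.graph.Edge, ¬ 𝒢.graph.IsClosedEdge e)
    (v : 𝒢.graph.Vertex) (C : Subgroup c.G) :
    ∃ H ∈ verticialSubgroups c v, C ≤ H :=
  ⟨⊤, c.top_mem_verticialSubgroups_of_forall_not_isClosedEdge' h37 hcl v, le_top⟩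

end ProfiniteSemiGraph

end Literature.AnabelianGeometry.SemiGraphs

end
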